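import Mathlib
import HarnessLib
import Summits.AtomisticToContinuum.Crystallization.Theorems.PricedLinkCensusSoftLayerPropagationStubBallPropagationNumerics

/-!
# Local layer propagation, HCP case: the radii schedules (parametric in the ball radius)

Route `BrittleRungDescent`, support item `SoftLayerPropagation` (stmt-AtomisticToContinuum-9210),
helper file: pure real arithmetic (η = 0; vocabulary of `PricedLinkCensus…Numerics.lean`).

The reconstruction of the HCP case works in a frame whose base plane is the mirror plane of an HCP
shell, with the moved point `u′` at height `a𝗁`, `0 ≤ a𝗁 ≤ R − 3/2`, patterns available in the
open `(2R − 2)`-ball about `u′`, `R ≥ 4`.  The layers `k𝗁`, `k = 0, 1, …, N` above the base carry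
certified discs of radii `P k = P 0 − 0.76 k` (`P 0 = √((2R−2)² − (a𝗁)² − 1)`) and rings of radii
`P k + 1.55`; below the base the discs start from `√(3R² − 6.4R + 3)`.

* `up_schedule`, `down_schedule` — the schedules with every real-arithmetic fact the reconstruction
  uses: the hypotheses of `layers_up` / `layers_down` (`√2 ≤ P`, ring, parent, far corner, the
  pattern ball) and the coverage of the `(R − 4/5)`-ball about `u′` by the certified discs.

All statements are elementary ([folklore]).
-/

noncomputable section

namespace Summit.AtomisticToContinuum.Crystallization.Theorems

open Literature.Geometry.DiscreteGeometry Literature.MathematicalPhysics.StatisticalMechanics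

/-- `1/𝗁 < 0.6125` and `8/3 · t² = (t𝗁)²`. [folklore] -/
theorem inv_layerSpacing_lt : layerSpacing⁻¹ < 0.6125 := by
  obtain ⟨h1, -⟩ := layerSpacing_bounds
  rw [inv_lt_comm₀ layerSpacing_pos (by norm_num)]
  exact lt_trans (by norm_num) h1

/-- `(8/3) t² = (t 𝗁)²`. [folklore] -/
theorem eight_thirds_mul_sq (t : ℝ) : 8 / 3 * t ^ 2 = (t * layerSpacing) ^ 2 := by
  rw [mul_pow, layerSpacing_sq]; ring

/-- From `(8/3) t² ≤ r²`, `0 ≤ r`: `t ≤ r/𝗁`. [folklore] -/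
theorem le_div_layerSpacing_of_sq_le {t r : ℝ} (hr : 0 ≤ r) (h : 8 / 3 * t ^ 2 ≤ r ^ 2) :
    t ≤ r / layerSpacing := by
  rw [eight_thirds_mul_sq] at h
  have h1 := abs_le_of_sq_le_sq' h hr
  rw [le_div_iff₀ layerSpacing_pos]
  exact h1.2

/-- **The ring inequality for the schedules**: `(P + 1.55 − √3)² < P² − 1` for `P ≥ 3`.
[folklore] -/
theorem ring_ineq_sched {P : ℝ} (hP : 3 ≤ P) : (P + 1.55 - Real.sqrt 3) ^ 2 < P ^ 2 - 1 := by
  obtain ⟨h1, h2⟩ := sqrt_three_bounds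
  nlinarith

/-- **The two-spring inequality**: `(P₀ − λk)² + (8/3)(k − a)² ≥ (5000/6083)(P₀ − λa)²`
(`λ = 0.76`; the minimum over real `k` of the left side). [folklore] -/
theorem two_spring (P₀ k a : ℝ) :
    5000 / 6083 * (P₀ - 0.76 * a) ^ 2 ≤ (P₀ - 0.76 * k) ^ 2 + 8 / 3 * (k - a) ^ 2 := by
  nlinarith [sq_nonneg ((0.76 ^ 2 + 8 / 3) * k - 0.76 * P₀ - 8 / 3 * a)]

/-- **The schedule above the base (HCP case, radius `R ≥ 4`, height `a𝗁 ≤ R − 3/2`).**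
[folklore] -/
theorem up_schedule {R a : ℝ} (hR : 4 ≤ R) (ha0 : 0 ≤ a) (ha : a * layerSpacing ≤ R - 3 / 2) :
    ∃ (N : ℕ) (P Rr : ℕ → ℝ),
      P 0 = Real.sqrt ((2 * R - 2) ^ 2 - 8 / 3 * a ^ 2 - 1) ∧
      P 0 ^ 2 + 8 / 3 * a ^ 2 < (2 * R - 2) ^ 2 ∧
      (∀ n ≤ N, Real.sqrt 2 ≤ P n) ∧
      (∀ n < N, ∀ r : ℝ, P n < r → r ≤ Rr n →
        ∃ t : ℝ, 0 < t ∧ 4 / 3 * t ^ 2 < r ^ 2 ∧ r ^ 2 - (4 * t - 4) ≤ P n ^ 2) ∧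
      (∀ n < N, ∀ r M : ℝ, 0 ≤ r → r ≤ P (n + 1) → 0 ≤ M → r ^ 2 ≤ 3 * M ^ 2 →
        r ^ 2 - 2 * M + 4 / 3 ≤ P n ^ 2) ∧
      (∀ n < N, P (n + 1) + 4 / Real.sqrt 3 ≤ Rr n) ∧
      (∀ n < N, ∀ x : ℝ, 0 ≤ x → x ≤ P (n + 1) →
        x ^ 2 + 8 / 3 * ((n : ℝ) + 1 - a) ^ 2 < (2 * R - 2) ^ 2) ∧
      (∀ (k : ℕ) (x : ℝ), 0 ≤ x → x + 8 / 3 * ((k : ℝ) - a) ^ 2 ≤ (R - 4 / 5) ^ 2 →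
        k ≤ N ∧ x ≤ P k ^ 2) := by
  obtain ⟨hh1, hh2⟩ := layerSpacing_bounds
  have hh := layerSpacing_pos
  have hil := inv_layerSpacing_lt
  -- the base radius
  set K : ℝ := (2 * R - 2) ^ 2 - 8 / 3 * a ^ 2 - 1 with hK
  have ha2 : 8 / 3 * a ^ 2 ≤ (R - 3 / 2) ^ 2 := by
    rw [eight_thirds_mul_sq]
    exact pow_le_pow_left₀ (by positivity) ha 2
  have hamax : a * 1.6329 ≤ R - 3 / 2 := le_trans (mul_le_mul_of_nonneg_left hh1.le ha0) ha
  have hKlow : (1.732 * R - 1.6) ^ 2 ≤ K := by rw [hK]; nlinarith only [hR, ha2, sq_nonneg R]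
  have hK0 : 0 ≤ K := le_trans (sq_nonneg _) hKlow
  set P₀ : ℝ := Real.sqrt K with hP₀
  have hP₀sq : P₀ ^ 2 = K := Real.sq_sqrt hK0
  have hP₀low : 1.732 * R - 1.6 ≤ P₀ := by
    rw [hP₀, Real.le_sqrt (by linarith) hK0]; exact hKlow
  have hP₀0 : 0 ≤ P₀ := Real.sqrt_nonneg _
  -- the number of layers
  set N : ℕ := ⌊a + (R - 4 / 5) / layerSpacing⌋₊ with hN
  have hdiv : (R - 4 / 5) / layerSpacing ≤ 0.6125 * (R - 4 / 5) := by
    rw [div_eq_mul_inv, mul_comm]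
    exact mul_le_mul_of_nonneg_right hil.le (by linarith)
  have hdiv0 : 0 ≤ (R - 4 / 5) / layerSpacing := div_nonneg (by linarith) hh.le
  have hNle : (N : ℝ) ≤ a + 0.6125 * (R - 4 / 5) :=
    (Nat.floor_le (by linarith)).trans (by linarith)
  -- the radii
  set P : ℕ → ℝ := fun n => P₀ - 0.76 * n with hPdef
  set Rr : ℕ → ℝ := fun n => P₀ - 0.76 * n + 1.55 with hRrdef
  have hPn : ∀ n : ℕ, n ≤ N → 2.67 ≤ P n := by
    intro n hn
    have hn' : (n : ℝ) ≤ N := by exact_mod_cast hn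
    simp only [hPdef]
    linarith only [hn', hNle, hP₀low, hamax, hR]
  have hPmono : ∀ n : ℕ, P (n + 1) + 0.76 = P n := by
    intro n; simp only [hPdef]; push_cast; ring
  refine ⟨N, P, Rr, by simp [hPdef, hP₀], ?_, ?_, ?_, ?_, ?_, ?_, ?_⟩
  · -- base disc inside the pattern ball
    have : P 0 = P₀ := by simp [hPdef]
    rw [this, hP₀sq, hK]; linarith
  · intro n hn
    exact le_trans (by linarith [sqrt_two_le]) (hPn n hn)
  · intro n hn
    have h1 := hPn (n + 1) hn
    have h2 := hPmono n
    refine ring_hyp_of (by linarith) (by simp only [hPdef, hRrdef]; linarith) ?_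
    simp only [hPdef, hRrdef]
    have h3 : (3 : ℝ) ≤ P₀ - 0.76 * n := by simp only [hPdef] at h1 h2; linarith
    exact ring_ineq_sched h3
  · intro n hn
    have h1 := hPn (n + 1) hn
    have h2 := hPmono n
    exact par_hyp_of (by linarith) (by linarith)
  · intro n hn
    refine far_of_gap ?_
    simp only [hPdef, hRrdef]; push_cast; linarith
  · -- the pattern ball
    intro n hn x hx0 hx
    have hm : ((n : ℝ) + 1) ≤ N := by exact_mod_cast Nat.succ_le_of_lt hn
    have hp : P (n + 1) = P₀ - 0.76 * ((n : ℝ) + 1) := by simp only [hPdef]; push_cast; ring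
    have h1 := hPn (n + 1) (Nat.succ_le_of_lt hn)
    have hx2 : x ^ 2 ≤ (P₀ - 0.76 * ((n : ℝ) + 1)) ^ 2 := by
      rw [← hp]; exact pow_le_pow_left₀ hx0 hx 2
    have hm0 : (0 : ℝ) ≤ (n : ℝ) + 1 := by positivity
    have hneg : (0.76 ^ 2 + 8 / 3) * ((n : ℝ) + 1) - 16 / 3 * a - 1.52 * P₀ ≤ 0 := by
      linarith only [hm, hNle, hP₀low, hamax, hR, ha0]
    nlinarith only [mul_nonpos_of_nonneg_of_nonpos hm0 hneg, hx2, hP₀sq, hK]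
  · -- coverage of the `(R − 4/5)`-ball by the certified discs
    intro k x hx0 hkx
    have hsq : 8 / 3 * ((k : ℝ) - a) ^ 2 ≤ (R - 4 / 5) ^ 2 := by linarith
    have hk1 : (k : ℝ) - a ≤ (R - 4 / 5) / layerSpacing := le_div_layerSpacing_of_sq_le (by linarith) hsq
    have hkN : k ≤ N := Nat.le_floor (by linarith only [hk1])
    refine ⟨hkN, ?_⟩
    have hts := two_spring P₀ k a
    have hw : 1.2665 * R - 0.902 ≤ P₀ - 0.76 * a := by linarith only [hP₀low, hamax, hR]
    have hw2 : (1.2665 * R - 0.902) ^ 2 ≤ (P₀ - 0.76 * a) ^ 2 :=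
      pow_le_pow_left₀ (by linarith only [hR]) hw 2
    simp only [hPdef]
    nlinarith only [hkx, hts, hw2, hR, sq_nonneg (R - 4)]

/-- **The schedule below the base (HCP case).**  The discs start from `√(3R² − 6.4R + 3)`
(at most the base radius) so that every layer used stays inside the pattern ball. [folklore] -/
theorem down_schedule {R a : ℝ} (hR : 4 ≤ R) (ha0 : 0 ≤ a) (ha : a * layerSpacing ≤ R - 3 / 2) :
    ∃ (N : ℕ) (P Rr : ℕ → ℝ),
      P 0 ≤ Real.sqrt ((2 * R - 2) ^ 2 - 8 / 3 * a ^ 2 - 1) ∧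
      (∀ n ≤ N, Real.sqrt 2 ≤ P n) ∧
      (∀ n < N, ∀ r : ℝ, P n < r → r ≤ Rr n →
        ∃ t : ℝ, 0 < t ∧ 4 / 3 * t ^ 2 < r ^ 2 ∧ r ^ 2 - (4 * t - 4) ≤ P n ^ 2) ∧
      (∀ n < N, ∀ r M : ℝ, 0 ≤ r → r ≤ P (n + 1) → 0 ≤ M → r ^ 2 ≤ 3 * M ^ 2 →
        r ^ 2 - 2 * M + 4 / 3 ≤ P n ^ 2) ∧
      (∀ n < N, P (n + 1) + 4 / Real.sqrt 3 ≤ Rr n) ∧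
      (∀ n < N, ∀ x : ℝ, 0 ≤ x → x ≤ P (n + 1) →
        x ^ 2 + 8 / 3 * ((n : ℝ) + 1 + a) ^ 2 < (2 * R - 2) ^ 2) ∧
      (∀ (k : ℕ) (x : ℝ), 1 ≤ k → 0 ≤ x → x + 8 / 3 * ((k : ℝ) + a) ^ 2 ≤ (R - 4 / 5) ^ 2 →
        k ≤ N ∧ x ≤ P k ^ 2) := by
  obtain ⟨hh1, hh2⟩ := layerSpacing_bounds
  have hh := layerSpacing_pos
  have hil := inv_layerSpacing_lt
  have ha2 : 8 / 3 * a ^ 2 ≤ (R - 3 / 2) ^ 2 := by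
    rw [eight_thirds_mul_sq]
    exact pow_le_pow_left₀ (by positivity) ha 2
  -- the starting radius
  set K : ℝ := 3 * R ^ 2 - 6.4 * R + 3 with hK
  have hKlow : (1.732 * R - 1.9) ^ 2 ≤ K := by rw [hK]; nlinarith only [hR, sq_nonneg R]
  have hK0 : 0 ≤ K := le_trans (sq_nonneg _) hKlow
  set P₀ : ℝ := Real.sqrt K with hP₀
  have hP₀sq : P₀ ^ 2 = K := Real.sq_sqrt hK0
  have hP₀low : 1.732 * R - 1.9 ≤ P₀ := by
    rw [hP₀, Real.le_sqrt (by linarith) hK0]; exact hKlow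
  have hP₀0 : 0 ≤ P₀ := Real.sqrt_nonneg _
  -- the number of layers
  set N : ℕ := ⌊(R - 4 / 5) / layerSpacing - a⌋₊ with hN
  have hdiv : (R - 4 / 5) / layerSpacing ≤ 0.6125 * (R - 4 / 5) := by
    rw [div_eq_mul_inv, mul_comm]
    exact mul_le_mul_of_nonneg_right hil.le (by linarith)
  have hNle : (N : ℝ) ≤ 0.6125 * (R - 4 / 5) := by
    rcases le_or_gt 0 ((R - 4 / 5) / layerSpacing - a) with h0 | h0
    · exact (Nat.floor_le h0).trans (by linarith)
    · have : N = 0 := by rw [hN]; exact Nat.floor_of_nonpos h0.le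
      rw [this]; push_cast; linarith only [hR]
  have hNle' : ∀ n : ℕ, 1 ≤ n → n ≤ N → (n : ℝ) ≤ (R - 4 / 5) / layerSpacing - a := by
    intro n h1 hn
    have hN1 : 1 ≤ N := h1.trans hn
    rcases le_or_gt 0 ((R - 4 / 5) / layerSpacing - a) with h0 | h0
    · exact (show (n : ℝ) ≤ N by exact_mod_cast hn).trans (Nat.floor_le h0)
    · have : N = 0 := by rw [hN]; exact Nat.floor_of_nonpos h0.le
      omega
  -- the radii
  set P : ℕ → ℝ := fun n => P₀ - 0.76 * n with hPdef
  set Rr : ℕ → ℝ := fun n => P₀ - 0.76 * n + 1.55 with hRrdef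
  have hPn : ∀ n : ℕ, n ≤ N → 3.5 ≤ P n := by
    intro n hn
    have hn' : (n : ℝ) ≤ N := by exact_mod_cast hn
    simp only [hPdef]
    linarith only [hn', hNle, hP₀low, hR]
  have hPmono : ∀ n : ℕ, P (n + 1) + 0.76 = P n := by
    intro n; simp only [hPdef]; push_cast; ring
  refine ⟨N, P, Rr, ?_, ?_, ?_, ?_, ?_, ?_, ?_⟩
  · -- below the base radius
    have : P 0 = P₀ := by simp [hPdef]
    rw [this, hP₀]
    apply Real.sqrt_le_sqrt
    rw [hK]; nlinarith only [ha2, hR]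
  · intro n hn
    exact le_trans (by linarith [sqrt_two_le]) (hPn n hn)
  · intro n hn
    have h1 := hPn (n + 1) hn
    have h2 := hPmono n
    refine ring_hyp_of (by linarith) (by simp only [hPdef, hRrdef]; linarith) ?_
    simp only [hPdef, hRrdef]
    have h3 : (3 : ℝ) ≤ P₀ - 0.76 * n := by simp only [hPdef] at h1 h2; linarith
    exact ring_ineq_sched h3
  · intro n hn
    have h1 := hPn (n + 1) hn
    have h2 := hPmono n
    exact par_hyp_of (by linarith) (by linarith)
  · intro n hn
    refine far_of_gap ?_
    simp only [hPdef, hRrdef]; push_cast; linarith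
  · -- the pattern ball
    intro n hn x hx0 hx
    have hm : ((n : ℝ) + 1) ≤ (R - 4 / 5) / layerSpacing - a := by
      exact_mod_cast hNle' (n + 1) (by omega) (Nat.succ_le_of_lt hn)
    have h1 := hPn (n + 1) (Nat.succ_le_of_lt hn)
    have hx2 : x ^ 2 ≤ P (n + 1) ^ 2 := pow_le_pow_left₀ hx0 hx 2
    have hple : P (n + 1) ≤ P₀ := by
      simp only [hPdef]
      have : (0 : ℝ) ≤ ((n + 1 : ℕ) : ℝ) := by positivity
      linarith
    have hp2 : P (n + 1) ^ 2 ≤ K := by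
      rw [← hP₀sq]; exact pow_le_pow_left₀ (by linarith) hple 2
    have hma : ((n : ℝ) + 1 + a) * layerSpacing ≤ R - 4 / 5 := by
      have := hm
      rw [le_sub_iff_add_le, le_div_iff₀ hh] at this
      exact this
    have hsq : 8 / 3 * ((n : ℝ) + 1 + a) ^ 2 ≤ (R - 4 / 5) ^ 2 := by
      rw [eight_thirds_mul_sq]
      exact pow_le_pow_left₀ (by positivity) hma 2
    rw [hK] at hp2
    nlinarith only [hx2, hp2, hsq]
  · -- coverage of the `(R − 4/5)`-ball by the certified discs
    intro k x hk1 hx0 hkx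
    have hsq : 8 / 3 * ((k : ℝ) + a) ^ 2 ≤ (R - 4 / 5) ^ 2 := by linarith
    have hk2 : (k : ℝ) + a ≤ (R - 4 / 5) / layerSpacing := le_div_layerSpacing_of_sq_le (by linarith) hsq
    have hkN : k ≤ N := Nat.le_floor (by linarith only [hk2])
    refine ⟨hkN, ?_⟩
    have hts := two_spring P₀ k (-a)
    have hw2 : (1.732 * R - 1.9) ^ 2 ≤ (P₀ - 0.76 * (-a)) ^ 2 :=
      pow_le_pow_left₀ (by linarith only [hR]) (by linarith only [hP₀low, ha0]) 2
    simp only [hPdef]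
    nlinarith only [hkx, hts, hw2, hR, sq_nonneg (R - 4)]

end Summit.AtomisticToContinuum.Crystallization.Theorems
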